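import Summits.RiemannHypothesis.RiemannHypothesis.Theorems.Splittings.LiLowZeroBudgetPairs
import HarnessLib

/-!
# RH-free LOW-ZERO BUDGET [γ] — the FAR part (SketchG6B §8)

Cell rh-split, seat rh-split-li-bridge g6 (brief sha16 f79c5f09d8bcb036), card `run/shared/lean/pub/rh-split/cards/SPLIT-li-bridge.md` §13
(13.5 paper proof «SOUND ON PAPER», referee rh-split-ref g3 06:17:36Z; 13.17); kernel source `HOME/rh-split-li-bridge/SketchG6T.lean` sha16
911a043700f05677 (2287 l; = SketchG6B [γ] ++ SketchG6C [α][β] ++ Part D [δ] ++ Part T, re-pointed at the tree's `LiIncrMeanSquare` /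
`LiIncrBlockLaw`, p508264 / p508611).  Filed by rh-split-typer-2 g4 (lane (xi)(c)–(f)) as a chain of ten tree modules cut at the scratch's
section boundaries, decl text byte-verbatim; deltas = namespaces `RhSplit.LiBridgeG6B/C/D/T` ↦
`…Theorems.Splittings.{LiLowZeroBudget, LiIncrHighPart, LiIncrBlockLawOfRH}` (qualified cross-references rewritten), module docstrings, and
one-line docstrings added where the scratch had none.  END-TO-END statement of the chain (last file):
`LiIncrBlockLawOfRH.rh_iff_almostAllLiMonotone : RiemannHypothesis ↔ ∃ E ⊆ ℕ of natural density zero, ∀ n ≥ 1, n ∉ E → λ_n ≤ λ_{n+1}`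
— T-Li3 IN KERNEL, a RELABELLING of RH (RH-EQUIVALENT, PROVED; certifies nothing about RH; class (li, bridge) unchanged).

This file: §8 the FAR part `Σ_ρ Σ_{|γ−γ'|≥1} term ≤ 720 π · M L² (1 + L)`, `M = ⌈Y⌉`, `L = log(M+2)`.

HONEST LABEL: «SPLITTING SEARCH over kernel-typed RH-EQUIVALENCES; a splitting A ∧ B ⟹ RH is CONDITIONAL bookkeeping unless A and B are
both proved; nothing here bears on the truth of RH.»
-/

set_option linter.dupNamespace false

noncomputable section

namespace Summit.RiemannHypothesis.RiemannHypothesis.Theorems.Splittings.LiLowZeroBudget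

open Finset
open Literature.NumberTheory.LFunctions Literature.NumberTheory.LFunctions.SchoenfeldBound
open Summit.RiemannHypothesis.RiemannHypothesis.Theorems.LiTheory
open Summit.RiemannHypothesis.RiemannHypothesis.Theorems.Splittings.LiIncrMeanSquare.MeanSquare

/-! ## §8 The FAR part: `Σ_ρ Σ_{|γ−γ'|≥1} term ≤ 720 π · M L² (1 + L)`, `M = ⌈Y⌉`, `L = log(M+2)` -/

/-- The genuinely off-diagonal weight `m m'/|γ − γ'|` on far pairs (else `0`). -/
def farI (ρ ρ' : ℂ) : ℝ :=
  if 1 ≤ |ρ.im - ρ'.im| then mult ρ * mult ρ' / |ρ.im - ρ'.im| else 0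

/-- Auxiliary lemma `farI_nonneg` of the low-zero budget [γ] (FAR part) (li-bridge g6 `SketchG6T`; see the module docstring for its place in the argument). -/
theorem farI_nonneg {ρ ρ' : ℂ} (hm : 0 ≤ mult ρ) (hm' : 0 ≤ mult ρ') : 0 ≤ farI ρ ρ' := by
  unfold farI
  split_ifs
  · positivity
  · exact le_rfl

/-- Inner far sum for a fixed zero `ρ`, via `term_le_far`. -/
theorem inner_far_le (N : ℕ) {Y : ℝ} {ρ : ℂ} (hρ : ρ ∈ zerosBetween 0 Y) :
    ∑ ρ' ∈ (zerosBetween 0 Y).filter (fun ρ' ↦ ¬ |ρ.im - ρ'.im| < 1), term N ρ ρ'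
      ≤ 8 * Real.pi * ∑ ρ' ∈ zerosBetween 0 Y,
          (farI ρ ρ' + mult ρ * mult ρ' * (1 / ρ.im + 1 / ρ'.im)) := by
  have hγ := fourteen_lt_im hρ
  have hm := mult_nonneg le_rfl hρ
  have hπ := Real.pi_pos
  rw [Finset.sum_filter, Finset.mul_sum]
  apply Finset.sum_le_sum
  intro ρ' hρ'
  have hγ' := fourteen_lt_im hρ'
  have hm' := mult_nonneg le_rfl hρ'
  have hγ0 : 0 < ρ.im := by linarith
  have hγ0' : 0 < ρ'.im := by linarith
  by_cases h : |ρ.im - ρ'.im| < 1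
  · have hnn : ¬¬|ρ.im - ρ'.im| < 1 := not_not.2 h
    rw [if_neg hnn]
    unfold farI
    rw [if_neg (not_le.2 h)]
    positivity
  · rw [if_pos h]
    have hd : 1 ≤ |ρ.im - ρ'.im| := not_lt.1 h
    have hfar := term_le_far (N := N) hγ hγ' hm hm' hd
    unfold farI
    rw [if_pos hd]
    calc term N ρ ρ' ≤ _ := hfar
      _ = 8 * Real.pi * (mult ρ * mult ρ' / |ρ.im - ρ'.im| +
            mult ρ * mult ρ' * (1 / ρ.im + 1 / ρ'.im)) := by ring

/-- Block bound: for `ρ ∈ W_k`, `ρ' ∈ W_k'`: `farI ≤ 2 m m' / |k − k'|`. -/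
theorem farI_le_window {k k' : ℕ} {ρ ρ' : ℂ} (hρ : ρ ∈ zerosBetween (k : ℝ) (k + 1))
    (hρ' : ρ' ∈ zerosBetween (k' : ℝ) (k' + 1)) :
    farI ρ ρ' ≤ 2 * (mult ρ * mult ρ') / |(k : ℝ) - k'| := by
  obtain ⟨hk1, hk2, -, -, hm⟩ := mem_window hρ
  obtain ⟨hk1', hk2', -, -, hm'⟩ := mem_window hρ'
  unfold farI
  split_ifs with hd
  · have hkk : (k : ℝ) ≠ k' := by
      intro h
      rw [h] at hk1 hk2
      have : |ρ.im - ρ'.im| < 1 := by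
        rw [abs_lt]; constructor <;> linarith
      linarith
    have hkpos : 0 < |(k : ℝ) - k'| := abs_pos.2 (sub_ne_zero.2 hkk)
    have hdpos : 0 < |ρ.im - ρ'.im| := by linarith
    have hle : |(k : ℝ) - k'| ≤ 2 * |ρ.im - ρ'.im| := by
      rw [abs_le]
      constructor <;> linarith [le_abs_self (ρ.im - ρ'.im), neg_abs_le (ρ.im - ρ'.im)]
    rw [div_le_div_iff₀ hdpos hkpos]
    nlinarith [mul_nonneg hm hm']
  · positivity

/-- Total zero count up to `Y`: `Σ_{0<γ≤Y} m ≤ 3 M log(M+2)`. -/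
theorem count_le (Y : ℝ) :
    ∑ ρ ∈ zerosBetween 0 Y, mult ρ ≤ 3 * ⌈Y⌉₊ * Real.log ((⌈Y⌉₊ : ℝ) + 2) := by
  set M := ⌈Y⌉₊ with hM
  calc ∑ ρ ∈ zerosBetween 0 Y, mult ρ
      ≤ ∑ k ∈ range M, ∑ ρ ∈ zerosBetween (k : ℝ) (k + 1), mult ρ :=
        sum_le_windows (F := mult) fun b ρ h ↦ mult_nonneg le_rfl h
    _ ≤ ∑ k ∈ range M, 3 * Real.log ((M : ℝ) + 2) := by
        apply Finset.sum_le_sum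
        intro k hk
        rw [Finset.mem_range] at hk
        have hk' : (k : ℝ) ≤ M := by exact_mod_cast hk.le
        have : Real.log ((k : ℝ) + 2) ≤ Real.log ((M : ℝ) + 2) :=
          Real.log_le_log (by linarith [(Nat.cast_nonneg k : (0 : ℝ) ≤ k)]) (by linarith)
        linarith [sum_mult_window_nat k]
    _ = 3 * M * Real.log ((M : ℝ) + 2) := by
        rw [Finset.sum_const, Finset.card_range, nsmul_eq_mul]; ring

/-- Auxiliary lemma `log_nat_le_L` of the low-zero budget [γ] (FAR part) (li-bridge g6 `SketchG6T`; see the module docstring for its place in the argument). -/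
theorem log_nat_le_L (M : ℕ) : Real.log M ≤ Real.log ((M : ℝ) + 2) := by
  rcases Nat.eq_zero_or_pos M with h | h
  · subst h; simp only [Nat.cast_zero, Real.log_zero, zero_add]; exact Real.log_nonneg (by norm_num)
  · exact Real.log_le_log (by exact_mod_cast h) (by linarith)

/-- Reciprocal sum: `Σ_{0<γ≤Y} m/γ ≤ 6 L (1 + L)`. -/
theorem recip_le (Y : ℝ) :
    ∑ ρ ∈ zerosBetween 0 Y, mult ρ / ρ.im ≤
      6 * Real.log ((⌈Y⌉₊ : ℝ) + 2) * (1 + Real.log ((⌈Y⌉₊ : ℝ) + 2)) := by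
  set M := ⌈Y⌉₊ with hM
  set L := Real.log ((M : ℝ) + 2) with hL
  have hL0 : 0 ≤ L := Real.log_nonneg (by linarith [(Nat.cast_nonneg M : (0 : ℝ) ≤ M)])
  have h1 : ∑ ρ ∈ zerosBetween 0 Y, mult ρ / ρ.im ≤
      ∑ k ∈ range M, ∑ ρ ∈ zerosBetween (k : ℝ) (k + 1), mult ρ / ρ.im := by
    apply sum_le_windows (F := fun ρ ↦ mult ρ / ρ.im)
    intro b ρ h
    have := fourteen_lt_im h
    have := mult_nonneg le_rfl h
    positivity
  have h2 : ∀ k ∈ range M, ∑ ρ ∈ zerosBetween (k : ℝ) (k + 1), mult ρ / ρ.im ≤ 3 * L * (1 / (k : ℝ)) := by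
    intro k hk
    rw [Finset.mem_range] at hk
    have hk' : (k : ℝ) ≤ M := by exact_mod_cast hk.le
    have hlk : Real.log ((k : ℝ) + 2) ≤ L :=
      Real.log_le_log (by linarith [(Nat.cast_nonneg k : (0 : ℝ) ≤ k)]) (by linarith)
    have hterm : ∀ ρ ∈ zerosBetween (k : ℝ) (k + 1), mult ρ / ρ.im ≤ mult ρ * (1 / (k : ℝ)) := by
      intro ρ hρ
      obtain ⟨hk1, -, h14, hk13, hm⟩ := mem_window hρ
      rw [div_eq_mul_one_div]
      apply mul_le_mul_of_nonneg_left _ hm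
      exact one_div_le_one_div_of_le (by linarith) hk1.le
    calc ∑ ρ ∈ zerosBetween (k : ℝ) (k + 1), mult ρ / ρ.im
        ≤ ∑ ρ ∈ zerosBetween (k : ℝ) (k + 1), mult ρ * (1 / (k : ℝ)) := Finset.sum_le_sum hterm
      _ = (∑ ρ ∈ zerosBetween (k : ℝ) (k + 1), mult ρ) * (1 / (k : ℝ)) := by rw [Finset.sum_mul]
      _ ≤ (3 * Real.log ((k : ℝ) + 2)) * (1 / (k : ℝ)) :=
          mul_le_mul_of_nonneg_right (sum_mult_window_nat k) (by positivity)
      _ ≤ 3 * L * (1 / (k : ℝ)) := by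
          apply mul_le_mul_of_nonneg_right _ (by positivity); linarith
  have h3 := sum_inv_le M
  have h4 := log_nat_le_L M
  calc _ ≤ _ := h1
    _ ≤ ∑ k ∈ range M, 3 * L * (1 / (k : ℝ)) := Finset.sum_le_sum h2
    _ = 3 * L * ∑ k ∈ range M, 1 / (k : ℝ) := by rw [Finset.mul_sum]
    _ ≤ 3 * L * (2 * (1 + L)) := by
        apply mul_le_mul_of_nonneg_left _ (by positivity); linarith
    _ = 6 * L * (1 + L) := by ring

/-- The off-diagonal double sum: `Σ Σ farI ≤ 54 M L² (1 + L)`. -/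
theorem farI_total_le (Y : ℝ) :
    ∑ ρ ∈ zerosBetween 0 Y, ∑ ρ' ∈ zerosBetween 0 Y, farI ρ ρ' ≤
      54 * ⌈Y⌉₊ * Real.log ((⌈Y⌉₊ : ℝ) + 2) ^ 2 * (1 + Real.log ((⌈Y⌉₊ : ℝ) + 2)) := by
  set M := ⌈Y⌉₊ with hM
  set L := Real.log ((M : ℝ) + 2) with hL
  have hL0 : 0 ≤ L := Real.log_nonneg (by linarith [(Nat.cast_nonneg M : (0 : ℝ) ≤ M)])
  -- abbreviations
  set W : ℕ → Finset ℂ := fun k ↦ zerosBetween (k : ℝ) (k + 1) with hW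
  set S : ℕ → ℝ := fun k ↦ ∑ ρ ∈ W k, mult ρ with hS
  have hS0 : ∀ k, 0 ≤ S k := fun k ↦ sum_mult_window_nat_nonneg k
  have hS1 : ∀ k, k < M → S k ≤ 3 * L := by
    intro k hk
    have hk' : (k : ℝ) ≤ M := by exact_mod_cast hk.le
    have hlk : Real.log ((k : ℝ) + 2) ≤ L :=
      Real.log_le_log (by linarith [(Nat.cast_nonneg k : (0 : ℝ) ≤ k)]) (by linarith)
    linarith [sum_mult_window_nat k]
  -- step 1: inner decomposition
  have h1 : ∑ ρ ∈ zerosBetween 0 Y, ∑ ρ' ∈ zerosBetween 0 Y, farI ρ ρ' ≤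
      ∑ ρ ∈ zerosBetween 0 Y, ∑ k' ∈ range M, ∑ ρ' ∈ W k', farI ρ ρ' := by
    apply Finset.sum_le_sum
    intro ρ hρ
    exact sum_le_windows (F := fun ρ' ↦ farI ρ ρ')
      fun b ρ' h' ↦ farI_nonneg (mult_nonneg le_rfl hρ) (mult_nonneg le_rfl h')
  -- step 2: outer decomposition
  have h2 : ∑ ρ ∈ zerosBetween 0 Y, ∑ k' ∈ range M, ∑ ρ' ∈ W k', farI ρ ρ' ≤
      ∑ k ∈ range M, ∑ ρ ∈ W k, ∑ k' ∈ range M, ∑ ρ' ∈ W k', farI ρ ρ' := by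
    apply sum_le_windows (F := fun ρ ↦ ∑ k' ∈ range M, ∑ ρ' ∈ W k', farI ρ ρ')
    intro b ρ h
    apply Finset.sum_nonneg
    intro k' _
    apply Finset.sum_nonneg
    intro ρ' h'
    exact farI_nonneg (mult_nonneg le_rfl h) (mem_window h').2.2.2.2
  -- step 3: swap and bound each block
  have h3 : ∀ k ∈ range M, ∑ ρ ∈ W k, ∑ k' ∈ range M, ∑ ρ' ∈ W k', farI ρ ρ' ≤
      ∑ k' ∈ range M, 18 * L ^ 2 / |(k : ℝ) - k'| := by
    intro k hk
    rw [Finset.mem_range] at hk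
    rw [Finset.sum_comm]
    apply Finset.sum_le_sum
    intro k' hk'
    rw [Finset.mem_range] at hk'
    calc ∑ ρ ∈ W k, ∑ ρ' ∈ W k', farI ρ ρ'
        ≤ ∑ ρ ∈ W k, ∑ ρ' ∈ W k', (mult ρ * mult ρ') * (2 / |(k : ℝ) - k'|) := by
          apply Finset.sum_le_sum
          intro ρ hρ
          apply Finset.sum_le_sum
          intro ρ' hρ'
          have := farI_le_window hρ hρ'
          calc farI ρ ρ' ≤ _ := this
            _ = (mult ρ * mult ρ') * (2 / |(k : ℝ) - k'|) := by ring
      _ = (S k * S k') * (2 / |(k : ℝ) - k'|) := by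
          rw [hS]
          simp only
          rw [Finset.sum_mul_sum, Finset.sum_mul]
          apply Finset.sum_congr rfl
          intro ρ _
          rw [Finset.sum_mul]
      _ ≤ (3 * L) * (3 * L) * (2 / |(k : ℝ) - k'|) := by
          apply mul_le_mul_of_nonneg_right _ (by positivity)
          exact mul_le_mul (hS1 k hk) (hS1 k' hk') (hS0 k') (by positivity)
      _ = 18 * L ^ 2 / |(k : ℝ) - k'| := by ring
  -- step 4: the row sums
  have h4 : ∀ k ∈ range M, ∑ k' ∈ range M, 18 * L ^ 2 / |(k : ℝ) - k'| ≤
      18 * L ^ 2 * (3 * (1 + Real.log M)) := by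
    intro k hk
    rw [Finset.mem_range] at hk
    have e : ∑ k' ∈ range M, 18 * L ^ 2 / |(k : ℝ) - k'| =
        18 * L ^ 2 * ∑ k' ∈ range M, 1 / |(k : ℝ) - k'| := by
      rw [Finset.mul_sum]
      apply Finset.sum_congr rfl; intro k' _; ring
    rw [e]
    exact mul_le_mul_of_nonneg_left (sum_inv_abs_sub_le hk) (by positivity)
  have h5 := log_nat_le_L M
  calc _ ≤ _ := h1
    _ ≤ _ := h2
    _ ≤ ∑ k ∈ range M, ∑ k' ∈ range M, 18 * L ^ 2 / |(k : ℝ) - k'| := Finset.sum_le_sum h3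
    _ ≤ ∑ k ∈ range M, 18 * L ^ 2 * (3 * (1 + Real.log M)) := Finset.sum_le_sum h4
    _ = M * (18 * L ^ 2 * (3 * (1 + Real.log M))) := by
        rw [Finset.sum_const, Finset.card_range, nsmul_eq_mul]
    _ ≤ M * (18 * L ^ 2 * (3 * (1 + L))) := by
        apply mul_le_mul_of_nonneg_left _ (Nat.cast_nonneg M)
        apply mul_le_mul_of_nonneg_left _ (by positivity)
        linarith
    _ = 54 * M * L ^ 2 * (1 + L) := by ring

/-- The `1/γ + 1/γ'` double sum factorises: `= 2 · (Σ m) · (Σ m/γ)`. -/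
theorem recip_double_sum_eq (Y : ℝ) :
    ∑ ρ ∈ zerosBetween 0 Y, ∑ ρ' ∈ zerosBetween 0 Y, mult ρ * mult ρ' * (1 / ρ.im + 1 / ρ'.im) =
      2 * (∑ ρ ∈ zerosBetween 0 Y, mult ρ) * (∑ ρ ∈ zerosBetween 0 Y, mult ρ / ρ.im) := by
  have e : ∀ ρ ρ' : ℂ, mult ρ * mult ρ' * (1 / ρ.im + 1 / ρ'.im) =
      (mult ρ / ρ.im) * mult ρ' + mult ρ * (mult ρ' / ρ'.im) := by
    intro ρ ρ'; ring
  simp_rw [e, Finset.sum_add_distrib, ← Finset.mul_sum, ← Finset.sum_mul]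
  ring

/-- FAR TOTAL. -/
theorem far_total_le (N : ℕ) (Y : ℝ) :
    ∑ ρ ∈ zerosBetween 0 Y, ∑ ρ' ∈ (zerosBetween 0 Y).filter (fun ρ' ↦ ¬ |ρ.im - ρ'.im| < 1),
      term N ρ ρ' ≤
      720 * Real.pi * (⌈Y⌉₊ * Real.log ((⌈Y⌉₊ : ℝ) + 2) ^ 2 * (1 + Real.log ((⌈Y⌉₊ : ℝ) + 2))) := by
  set M := ⌈Y⌉₊ with hM
  set L := Real.log ((M : ℝ) + 2) with hL
  have hL0 : 0 ≤ L := Real.log_nonneg (by linarith [(Nat.cast_nonneg M : (0 : ℝ) ≤ M)])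
  have hπ := Real.pi_pos
  have hA := farI_total_le Y
  have hB := count_le Y
  have hC := recip_le Y
  have hB0 : 0 ≤ ∑ ρ ∈ zerosBetween 0 Y, mult ρ :=
    Finset.sum_nonneg fun ρ h ↦ mult_nonneg le_rfl h
  have hC0 : 0 ≤ ∑ ρ ∈ zerosBetween 0 Y, mult ρ / ρ.im :=
    Finset.sum_nonneg fun ρ h ↦ by
      have := fourteen_lt_im h; have := mult_nonneg le_rfl h; positivity
  rw [← hM] at hA hB hC
  rw [← hL] at hA hB hC
  calc _ ≤ ∑ ρ ∈ zerosBetween 0 Y, 8 * Real.pi * ∑ ρ' ∈ zerosBetween 0 Y,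
          (farI ρ ρ' + mult ρ * mult ρ' * (1 / ρ.im + 1 / ρ'.im)) :=
        Finset.sum_le_sum fun ρ hρ ↦ inner_far_le N hρ
    _ = 8 * Real.pi * (∑ ρ ∈ zerosBetween 0 Y, ∑ ρ' ∈ zerosBetween 0 Y, farI ρ ρ' +
          ∑ ρ ∈ zerosBetween 0 Y, ∑ ρ' ∈ zerosBetween 0 Y,
            mult ρ * mult ρ' * (1 / ρ.im + 1 / ρ'.im)) := by
        rw [← Finset.mul_sum, ← Finset.sum_add_distrib]
        congr 1
        apply Finset.sum_congr rfl
        intro ρ _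
        rw [Finset.sum_add_distrib]
    _ = 8 * Real.pi * (∑ ρ ∈ zerosBetween 0 Y, ∑ ρ' ∈ zerosBetween 0 Y, farI ρ ρ' +
          2 * (∑ ρ ∈ zerosBetween 0 Y, mult ρ) * (∑ ρ ∈ zerosBetween 0 Y, mult ρ / ρ.im)) := by
        rw [recip_double_sum_eq]
    _ ≤ 8 * Real.pi * (54 * M * L ^ 2 * (1 + L) + 2 * (3 * M * L) * (6 * L * (1 + L))) := by
        apply mul_le_mul_of_nonneg_left _ (by positivity)
        apply add_le_add hA
        exact mul_le_mul (mul_le_mul_of_nonneg_left hB (by norm_num)) hC hC0 (by positivity)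
    _ = 720 * Real.pi * (M * L ^ 2 * (1 + L)) := by ring

end Summit.RiemannHypothesis.RiemannHypothesis.Theorems.Splittings.LiLowZeroBudget

end
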